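import Mathlib.Combinatorics.SetFamily.LYM
import Summits.CriticalPhenomena.PercolationContinuityZ3.Theorems.SahiMasterFamilyTotalMeetStratum

/-!
# Sahi's hierarchy collapses at the WIDTH of the poset — for every probability weight

Companion of `SahiMasterFamilyTotalMeetStratum.lean` and `SahiMasterFamilyC3NotC4.lean` (crux `NoHeavyLowerTail`,
stmt-CriticalPhenomena-4575; cell `prim-masterthm`, seat P4 "induction on `k`", unit `prim-masterthm-p4-g3`).  Vocabulary:
`SahiPositive μ n` (`E_n ≥ 0` on nonnegative monotone `n`-families [Sahi2008, Conj. 5; LiebSahi2021, Conj. 1.1]),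
`sahiPositive_iff_indicators` [LiebSahi2021, Lemma 2.2], the total-meet rung `sahiE_cons_ge_of_absorb_prod` (this seat, gen 2).

THE THEOREM (`sahiPositive_all_of_width`, no lattice, no FKG, ANY nonnegative probability weight `μ` on a finite preorder `α`):
if `α` has no `w + 1` pairwise incomparable points (width `≤ w`), then

  `(∀ n ≤ max w 2, SahiPositive μ n) → ∀ n, SahiPositive μ n`.

So the infinite hierarchy `C_1, C_2, C_3, …` of [Sahi2008]/[LiebSahi2021] is, law by law, equivalent to its first `max w 2` members.
MECHANISM.  (1) `exists_absorbing_of_width` — among any `w + 1` up-sets `U_0,…,U_w` of a preorder of width `≤ w` some `U_m`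
contains `⋂_{j ≠ m} U_j`: otherwise pick `x_i ∈ ⋂_{j≠i} U_j ∖ U_i`; for `i ≠ j`, `x_i ∈ U_j ∌ x_j` and `U_j` is an up-set, so
`x_i ≰ x_j` — `w + 1` pairwise incomparable points.  (Conversely an antichain `x_0,…,x_w` gives the irredundant family
`U_i = ↑{x_j : j ≠ i}`, so (1) characterises width `≤ w`.)  (2) The total-meet rung of `SahiMasterFamilyTotalMeetStratum`
(`sahiE_cons_ge_of_absorb_prod`, any nonnegative weight): a slot `d = 1_{U_m}` absorbing the product of the other indicator slots gives
`E_{k+3} ≥ (k + 2 − μ(U_m))·E_{k+2}(others) ≥ 0` once all proper sub-families are nonnegative.  (3) Strong induction on the order,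
through the reduction to indicators of up-sets.

COROLLARIES.  `sahiPositive_all_finset_of_le_choose`: on the Boolean lattice `Finset β` (width `C(|β|, ⌊|β|/2⌋)` by Sperner's
theorem, Mathlib `IsAntichain.sperner`) orders `≤ max C(|β|,⌊|β|/2⌋) 2` suffice; `sahiPositive_all_iff_three_cube3`: on `2³ =
Finset (Fin 3)` a probability weight is Sahi-positive of EVERY order iff it is of order `3`; `sahiPositive_all_iff_six_cube4`: on
`2⁴`, iff of orders `≤ 6`.  SHARPNESS (recorded, not needed here): the order cannot be lowered below the width in the first cases —
width 3: the cube `2³` carries Kahn's positively associated law with `E_3 < 0` ([cite: Kahn2022, Cor 4 and p.3]; tree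
`SahiMasterFamilyAssocNotC3`), width 4: the poset `{⊥ < m_0..m_3 < ⊤}` carries a law with `C_1, C_2, C_3` and `E_4 < 0`
(`SahiMasterFamilyC3NotC4`, this seat), and width 5: `{⊥ < m_0..m_4 < ⊤}` with `(5;1,1,1,1,1;2)/12` has `C_{≤4}` and
`E_5 = −7/144` (exact census, seat notes; not formalised).  READING for the master-family induction on `k`: for a FIXED finite
ground set the `k → k+1` step is automatic above the width for every law whatsoever; all the difficulty of `C_k` (Kahn's Conj. 5 =
`C_3` on cubes, OPEN) sits at orders `k ≤` width, where the measure's structure must enter (`SahiMasterFamilyC3NotC4`).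
Everything here is proved; no named facts; nothing is asserted about `C_3` itself. [this work]
-/

namespace Summit.CriticalPhenomena.PercolationContinuityZ3.Theorems

open Finset Function
open Literature.Combinatorics.Sahi2008
open Literature.Probability.LatticeModels (mass mass_mono mass_univ)

namespace SahiWidthCollapse

variable {α : Type*} [Fintype α] [DecidableEq α]

/-! ### Width: among `w + 1` up-sets of a preorder of width `≤ w`, one contains the meet of the others -/

/-- **Irredundant families of up-sets come from antichains.**  If `α` has no `w + 1` pairwise incomparable points, then among any
`w + 1` up-sets some `U_m` contains `⋂_{j ≠ m} U_j`. [this work] -/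
theorem exists_absorbing_of_width [Preorder α] {w : ℕ}
    (hw : ∀ x : Fin (w + 1) → α, ∃ i j, i ≠ j ∧ x i ≤ x j)
    (U : Fin (w + 1) → Finset α) (hU : ∀ i, IsUpperSet ((U i : Finset α) : Set α)) :
    ∃ m, ∀ x, (∀ j, j ≠ m → x ∈ U j) → x ∈ U m := by
  by_contra h
  push Not at h
  choose x hx using h
  obtain ⟨i, j, hij, hle⟩ := hw x
  have hxiUj : x i ∈ U j := (hx i).1 j (Ne.symm hij)
  exact (hx j).2 (hU j hle hxiUj)

omit [Fintype α] [DecidableEq α] in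
/-- The width hypothesis passes to larger index types: no `w + 1` pairwise incomparable points ⇒ no `n` pairwise incomparable
points for `n ≥ w + 1`. [this work] -/
theorem width_mono [Preorder α] {w n : ℕ} (hwn : w + 1 ≤ n)
    (hw : ∀ x : Fin (w + 1) → α, ∃ i j, i ≠ j ∧ x i ≤ x j) (x : Fin n → α) :
    ∃ i j, i ≠ j ∧ x i ≤ x j := by
  obtain ⟨i, j, hij, hle⟩ := hw (fun l => x (Fin.castLE hwn l))
  exact ⟨Fin.castLE hwn i, Fin.castLE hwn j, fun h => hij (Fin.castLE_injective hwn h), hle⟩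

/-! ### The collapse -/

omit [DecidableEq α] in
/-- `E(1_A) ≤ 1` for a nonnegative probability weight. [folklore] -/
theorem ex_setInd_le_one [DecidableEq α] {μ : α → ℝ} (hμ0 : ∀ x, 0 ≤ μ x) (hμ1 : ∑ x, μ x = 1) (A : Finset α) :
    ex μ (setInd A) ≤ 1 := by
  rw [ex_setInd, ← hμ1, ← mass_univ]
  exact mass_mono (fun x => hμ0 x) (subset_univ A)

/-- **The step above the width** (any nonnegative probability weight): if `α` has no `k + 3` pairwise incomparable points and
`μ` is Sahi-positive of every order `≤ k + 2`, then it is Sahi-positive of order `k + 3`. [this work] -/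
theorem sahiPositive_succ_of_width [Preorder α] (μ : α → ℝ) (hμ0 : ∀ x, 0 ≤ μ x) (hμ1 : ∑ x, μ x = 1) (k : ℕ)
    (hw : ∀ x : Fin (k + 3) → α, ∃ i j, i ≠ j ∧ x i ≤ x j)
    (hpos : ∀ n ≤ k + 2, SahiPositive μ n) : SahiPositive μ (k + 3) := by
  rw [sahiPositive_iff_indicators]
  intro U hU
  obtain ⟨m, hm⟩ := exists_absorbing_of_width hw U hU
  set F : Fin (k + 3) → α → ℝ := fun i => setInd (U i) with hF
  -- move the absorbing slot to the head
  have hmove : sahiE μ (k + 3) F = sahiE μ (k + 3) (Fin.cons (F m) (m.removeNth F) : Fin (k + 3) → α → ℝ) := by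
    have h := SahiMeetTowerAll.sahiE_update_eq_sahiE_cons μ (k + 2) F m (F m)
    rwa [update_eq_self] at h
  rw [hmove]
  -- the total-meet rung
  have hrung := sahiE_cons_ge_of_absorb_prod μ hμ0 k (F m) (m.removeNth F)
    (fun i x => by simp only [Fin.removeNth, hF]; exact setInd_nonneg _ _)
    (fun x => by
      simp only [hF, setInd_apply]
      split_ifs <;> norm_num)
    (fun x => by
      by_cases hx : x ∈ U m
      · simp only [hF, setInd_apply, hx, if_true, mul_one]
      · -- some other slot vanishes at `x`
        have hx' : ∃ j, j ≠ m ∧ x ∉ U j := by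
          by_contra hc
          push Not at hc
          exact hx (hm x hc)
        obtain ⟨j, hjm, hxj⟩ := hx'
        obtain ⟨l, hl⟩ := Fin.exists_succAbove_eq hjm
        have hzero : ∏ i, (m.removeNth F) i x = 0 := by
          apply Finset.prod_eq_zero (Finset.mem_univ l)
          simp only [Fin.removeNth, hF, hl, setInd_apply, hxj, if_false]
        rw [hzero, zero_mul])
    (fun j e => by
      have hj : j + 1 ≤ k + 2 := by
        have := Fintype.card_le_of_embedding e
        simp only [Fintype.card_fin] at this
        exact this
      have hP := (sahiPositive_iff_indicators μ (j + 1)).1 (hpos (j + 1) hj)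
        (fun l => U (m.succAbove (e l))) (fun l => hU _)
      simpa only [Fin.removeNth, hF] using hP)
  -- the lower-order factor is nonnegative
  have hlow : 0 ≤ sahiE μ (k + 2) (m.removeNth F) := by
    have hP := (sahiPositive_iff_indicators μ (k + 2)).1 (hpos (k + 2) le_rfl)
      (fun l => U (m.succAbove l)) (fun l => hU _)
    exact hP
  have hcoef : 0 ≤ (k : ℝ) + 2 - ex μ (F m) := by
    have h1 : ex μ (F m) ≤ 1 := ex_setInd_le_one hμ0 hμ1 (U m)
    have hk : (0 : ℝ) ≤ k := Nat.cast_nonneg k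
    linarith
  exact le_trans (mul_nonneg hcoef hlow) hrung

/-- **Sahi's hierarchy collapses at the width.**  For a nonnegative probability weight `μ` on a finite preorder with no `w + 1`
pairwise incomparable points: Sahi positivity of all orders `≤ max w 2` implies Sahi positivity of EVERY order. [this work] -/
theorem sahiPositive_all_of_width [Preorder α] (μ : α → ℝ) (hμ0 : ∀ x, 0 ≤ μ x) (hμ1 : ∑ x, μ x = 1) {w : ℕ}
    (hw : ∀ x : Fin (w + 1) → α, ∃ i j, i ≠ j ∧ x i ≤ x j)
    (hpos : ∀ n ≤ max w 2, SahiPositive μ n) : ∀ n, SahiPositive μ n := by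
  intro n
  induction n using Nat.strong_induction_on with
  | _ n ih =>
    by_cases hn : n ≤ max w 2
    · exact hpos n hn
    · push Not at hn
      obtain ⟨k, rfl⟩ : ∃ k, n = k + 3 := ⟨n - 3, by omega⟩
      refine sahiPositive_succ_of_width μ hμ0 hμ1 k (fun x => width_mono (by omega) hw x) ?_
      intro j hj
      exact ih j (by omega)

/-- The same with the hypothesis at the orders `≤ w` only, when `w ≥ 2`. [this work] -/
theorem sahiPositive_all_of_width' [Preorder α] (μ : α → ℝ) (hμ0 : ∀ x, 0 ≤ μ x) (hμ1 : ∑ x, μ x = 1) {w : ℕ}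
    (h2 : 2 ≤ w) (hw : ∀ x : Fin (w + 1) → α, ∃ i j, i ≠ j ∧ x i ≤ x j)
    (hpos : ∀ n ≤ w, SahiPositive μ n) : ∀ n, SahiPositive μ n :=
  sahiPositive_all_of_width μ hμ0 hμ1 hw (fun n hn => hpos n (by rw [max_eq_left h2] at hn; exact hn))

/-! ### Boolean lattices: Sperner's bound on the width -/

/-- **Width of the Boolean lattice** (Sperner): `Finset β` has no `C(|β|,⌊|β|/2⌋) + 1` pairwise `⊆`-incomparable members.
[folklore; Mathlib `IsAntichain.sperner`] -/
theorem finset_width_le_choose {β : Type*} [Fintype β] [DecidableEq β]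
    (x : Fin ((Fintype.card β).choose (Fintype.card β / 2) + 1) → Finset β) :
    ∃ i j, i ≠ j ∧ x i ≤ x j := by
  by_contra h
  push Not at h
  have hinj : Function.Injective x := by
    intro i j hij
    by_contra hne
    exact h i j hne (hij ▸ le_rfl)
  set 𝒜 : Finset (Finset β) := univ.image x with h𝒜
  have hanti : IsAntichain (· ⊆ ·) (𝒜 : Set (Finset β)) := by
    intro s hs t ht hst
    simp only [h𝒜, coe_image, coe_univ, Set.image_univ, Set.mem_range] at hs ht
    obtain ⟨i, rfl⟩ := hs
    obtain ⟨j, rfl⟩ := ht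
    exact h i j (fun hij => hst (hij ▸ rfl))
  have hcard : #𝒜 = (Fintype.card β).choose (Fintype.card β / 2) + 1 := by
    rw [h𝒜, card_image_of_injective _ hinj, card_univ, Fintype.card_fin]
  have hsp := hanti.sperner
  omega

/-- **Collapse on the Boolean lattice `Finset β`**: for a nonnegative probability weight, Sahi positivity of all orders
`≤ max C(|β|,⌊|β|/2⌋) 2` implies every order. [this work] -/
theorem sahiPositive_all_finset_of_le_choose {β : Type*} [Fintype β] [DecidableEq β] (μ : Finset β → ℝ)
    (hμ0 : ∀ x, 0 ≤ μ x) (hμ1 : ∑ x, μ x = 1)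
    (hpos : ∀ n ≤ max ((Fintype.card β).choose (Fintype.card β / 2)) 2, SahiPositive μ n) :
    ∀ n, SahiPositive μ n :=
  sahiPositive_all_of_width μ hμ0 hμ1 finset_width_le_choose hpos

/-- **The cube `2³`: `C_3` alone is every order.**  For a nonnegative probability weight on `Finset (Fin 3)` (= the Boolean lattice
`2³`, width `3`), Sahi positivity of order `3` is equivalent to Sahi positivity of every order.  (By [cite: Kahn2022, Cor 4 and p.3],
order `2` is NOT enough there.) [this work] -/
theorem sahiPositive_all_iff_three_cube3 (μ : Finset (Fin 3) → ℝ) (hμ0 : ∀ x, 0 ≤ μ x) (hμ1 : ∑ x, μ x = 1) :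
    (∀ n, SahiPositive μ n) ↔ SahiPositive μ 3 := by
  refine ⟨fun h => h 3, fun h3 => sahiPositive_all_finset_of_le_choose μ hμ0 hμ1 fun n hn => ?_⟩
  have hmax : max ((Fintype.card (Fin 3)).choose (Fintype.card (Fin 3) / 2)) 2 = 3 := by
    simp only [Fintype.card_fin]; decide
  rw [hmax] at hn
  exact h3.anti hμ0 hμ1 hn

/-- **The cube `2⁴`: orders `≤ 6` are every order** (width `C(4,2) = 6`), for every nonnegative probability weight on
`Finset (Fin 4)`.  (By `SahiMasterFamilyC3NotC4`, order `3` is not enough there.) [this work] -/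
theorem sahiPositive_all_iff_six_cube4 (μ : Finset (Fin 4) → ℝ) (hμ0 : ∀ x, 0 ≤ μ x) (hμ1 : ∑ x, μ x = 1) :
    (∀ n, SahiPositive μ n) ↔ SahiPositive μ 6 := by
  refine ⟨fun h => h 6, fun h6 => sahiPositive_all_finset_of_le_choose μ hμ0 hμ1 fun n hn => ?_⟩
  have hmax : max ((Fintype.card (Fin 4)).choose (Fintype.card (Fin 4) / 2)) 2 = 6 := by
    simp only [Fintype.card_fin]; decide
  rw [hmax] at hn
  exact h6.anti hμ0 hμ1 hn

/-! ### Appendix (gen 3, same seat): the rung as an inequality, the IRREDUNDANT-FAMILY reduction, and descent of zeros -/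

/-- **The total-meet rung for an indicator family with an absorbing member** (any nonnegative probability weight): if `μ` is Sahi-positive of
every order `≤ k + 2` and `U_m ⊇ ⋂_{j ≠ m} U_j`, then `E_{k+3}(1_U) ≥ (k + 2 − μ(U_m))·E_{k+2}(1_{U_{−m}})` and `E_{k+2}(1_{U_{−m}}) ≥ 0`. [this work] -/
theorem sahiE_setInd_ge_of_absorbing [Preorder α] (μ : α → ℝ) (hμ0 : ∀ x, 0 ≤ μ x) (k : ℕ)
    (hpos : ∀ n ≤ k + 2, SahiPositive μ n) (U : Fin (k + 3) → Finset α) (hU : ∀ i, IsUpperSet ((U i : Finset α) : Set α))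
    (m : Fin (k + 3)) (hm : ∀ x, (∀ j, j ≠ m → x ∈ U j) → x ∈ U m) :
    ((k : ℝ) + 2 - ex μ (setInd (U m))) * sahiE μ (k + 2) (fun l => setInd (U (m.succAbove l))) ≤
        sahiE μ (k + 3) (fun i => setInd (U i)) ∧
      0 ≤ sahiE μ (k + 2) (fun l => setInd (U (m.succAbove l))) := by
  set F : Fin (k + 3) → α → ℝ := fun i => setInd (U i) with hF
  have hmove : sahiE μ (k + 3) F = sahiE μ (k + 3) (Fin.cons (F m) (m.removeNth F) : Fin (k + 3) → α → ℝ) := by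
    have h := SahiMeetTowerAll.sahiE_update_eq_sahiE_cons μ (k + 2) F m (F m)
    rwa [update_eq_self] at h
  have hrung := sahiE_cons_ge_of_absorb_prod μ hμ0 k (F m) (m.removeNth F)
    (fun i x => by simp only [Fin.removeNth, hF]; exact setInd_nonneg _ _)
    (fun x => by
      simp only [hF, setInd_apply]
      split_ifs <;> norm_num)
    (fun x => by
      by_cases hx : x ∈ U m
      · simp only [hF, setInd_apply, hx, if_true, mul_one]
      · have hx' : ∃ j, j ≠ m ∧ x ∉ U j := by
          by_contra hc
          push Not at hc
          exact hx (hm x hc)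
        obtain ⟨j, hjm, hxj⟩ := hx'
        obtain ⟨l, hl⟩ := Fin.exists_succAbove_eq hjm
        have hzero : ∏ i, (m.removeNth F) i x = 0 := by
          apply Finset.prod_eq_zero (Finset.mem_univ l)
          simp only [Fin.removeNth, hF, hl, setInd_apply, hxj, if_false]
        rw [hzero, zero_mul])
    (fun j e => by
      have hj : j + 1 ≤ k + 2 := by
        have := Fintype.card_le_of_embedding e
        simp only [Fintype.card_fin] at this
        exact this
      have hP := (sahiPositive_iff_indicators μ (j + 1)).1 (hpos (j + 1) hj)
        (fun l => U (m.succAbove (e l))) (fun l => hU _)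
      simpa only [Fin.removeNth, hF] using hP)
  have hlow : 0 ≤ sahiE μ (k + 2) (m.removeNth F) :=
    (sahiPositive_iff_indicators μ (k + 2)).1 (hpos (k + 2) le_rfl) (fun l => U (m.succAbove l)) (fun l => hU _)
  refine ⟨?_, hlow⟩
  rw [hmove]
  exact hrung

/-- **The irredundant-family reduction.**  To lift Sahi positivity from the orders `≤ k + 2` to the order `k + 3` (any nonnegative probability
weight on a finite preorder) it suffices to check `E_{k+3}(1_U) ≥ 0` on the IRREDUNDANT families of up-sets — those in which every member misses a
point lying in all the other members (equivalently: no member contains the meet of the others; such points form an antichain).  This is the reduction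
behind the unit's strictness census (`STRICTNESS-CENSUS.md`). [this work] -/
theorem sahiPositive_succ_of_irredundant [Preorder α] (μ : α → ℝ) (hμ0 : ∀ x, 0 ≤ μ x) (hμ1 : ∑ x, μ x = 1) (k : ℕ)
    (hpos : ∀ n ≤ k + 2, SahiPositive μ n)
    (hirr : ∀ U : Fin (k + 3) → Finset α, (∀ i, IsUpperSet ((U i : Finset α) : Set α)) →
      (∀ m, ∃ x, (∀ j, j ≠ m → x ∈ U j) ∧ x ∉ U m) → 0 ≤ sahiE μ (k + 3) (fun i => setInd (U i))) :
    SahiPositive μ (k + 3) := by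
  rw [sahiPositive_iff_indicators]
  intro U hU
  by_cases h : ∀ m, ∃ x, (∀ j, j ≠ m → x ∈ U j) ∧ x ∉ U m
  · exact hirr U hU h
  · push Not at h
    obtain ⟨m, hm⟩ := h
    obtain ⟨hr, hlow⟩ := sahiE_setInd_ge_of_absorbing μ hμ0 k hpos U hU m hm
    have hcoef : 0 ≤ (k : ℝ) + 2 - ex μ (setInd (U m)) := by
      have h1 : ex μ (setInd (U m)) ≤ 1 := ex_setInd_le_one hμ0 hμ1 (U m)
      have hk : (0 : ℝ) ≤ k := Nat.cast_nonneg k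
      linarith
    exact le_trans (mul_nonneg hcoef hlow) hr

/-- **Zeros descend at an absorbing member** (the equality-locus side of the rung): for a nonnegative probability weight Sahi-positive of the orders
`≤ k + 2`, if `U_m ⊇ ⋂_{j ≠ m} U_j` and `E_{k+3}(1_U) = 0` then `E_{k+2}(1_{U_{−m}}) = 0`.  Above the width (where every family has such a member) the
zeros of every order are therefore hereditary down to the order `max w 2`. [this work] -/
theorem sahiE_setInd_eq_zero_descends [Preorder α] (μ : α → ℝ) (hμ0 : ∀ x, 0 ≤ μ x) (hμ1 : ∑ x, μ x = 1) (k : ℕ)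
    (hpos : ∀ n ≤ k + 2, SahiPositive μ n) (U : Fin (k + 3) → Finset α) (hU : ∀ i, IsUpperSet ((U i : Finset α) : Set α))
    (m : Fin (k + 3)) (hm : ∀ x, (∀ j, j ≠ m → x ∈ U j) → x ∈ U m)
    (h0 : sahiE μ (k + 3) (fun i => setInd (U i)) = 0) :
    sahiE μ (k + 2) (fun l => setInd (U (m.succAbove l))) = 0 := by
  obtain ⟨hr, hlow⟩ := sahiE_setInd_ge_of_absorbing μ hμ0 k hpos U hU m hm
  have hcoef : 0 < (k : ℝ) + 2 - ex μ (setInd (U m)) := by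
    have h1 : ex μ (setInd (U m)) ≤ 1 := ex_setInd_le_one hμ0 hμ1 (U m)
    have hk : (0 : ℝ) ≤ k := Nat.cast_nonneg k
    linarith
  rw [h0] at hr
  have : ((k : ℝ) + 2 - ex μ (setInd (U m))) * sahiE μ (k + 2) (fun l => setInd (U (m.succAbove l))) = 0 :=
    le_antisymm hr (mul_nonneg hcoef.le hlow)
  rcases mul_eq_zero.1 this with h | h
  · exact absurd h hcoef.ne'
  · exact h

end SahiWidthCollapse

end Summit.CriticalPhenomena.PercolationContinuityZ3.Theorems
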